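import Summits.ValiantsHypothesis.ValiantsHypothesis.Theorems.ValuativeGCTValuativeFlipPerAnchorInheritanceEvery
import Summits.ValiantsHypothesis.ValiantsHypothesis.Theorems.ValuativeGCTValuativeFlipCertificateBridge
import Summits.ValiantsHypothesis.ValiantsHypothesis.Theorems.ValuativeGCTValuativeFlipDetEventualMonotone
import HarnessLib

/-!
# Twist positivity, IV: the every-`j` row-lift transfer along closure points (any `p, q`) and the
# determinant at EVERY step (crux `ValuativeGCT.ValuativeFlip`, stmt-ValiantsHypothesis-12624; wall-breaker k12
# gen 1, axis "representation-stability transfer between `m` and `m + 1`"; helper file `--supports`)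

* `orbitMultiplicity_le_rowLift_of_closurePoints`: for a form `p` of degree `m` on `MatIdx m`, `λ ⊢ m·δ` with at
  most `m²` parts, ANY `j`, and a nonzero form `q` of degree `m + j` on `MatIdx (m + j)` whose orbit closure
  contains `X_top^j · ι(A · p)` for all matrices `A`: `mult_{λ*} ℂ[Δ_m(p)] ≤ mult_{(λ♯(m+j))*} ℂ[Δ_{m+j}(q)]` —
  the tree's EVENTUAL principle `orbitMultiplicity_le_rowLift_eventually_of_closurePoints` (k16, p118342) made exact
  by twist positivity (parts I–III): lifted highest-weight vectors of a complement of `H ∩ tw⁻¹ I(GL·p)` have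
  linearly independent twisted evaluations at the padded points (`aeval_formCoeff_paddedForm_liftHWV`, certificate
  bridge at closure points), and `dim (H ∩ tw⁻¹ I) ≤ dim (H ∩ I) = dim H − mult`.
* `det_everyStepMonotone` (registered stub): `K_n(μ*) ≤ K_{n+j}((μ♯(n+j))*)` for EVERY `j` —
  `det_eventualMonotone` without threshold (BLMW 2011 Problem 6.10 "≥" for `g = det_n`).

Sources: BLMW, SIAM J. Comput. 40 (2011) §6.4 Problem 6.10; Ikenmeyer–Panova 2017 §2; Mulmuley–Sohoni 2001 Prop. 4.4;
this seat's `Cruxes/ValuativeFlip/TwistPositivityK12G1.md`. No new definitions.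
-/

set_option linter.dupNamespace false

namespace Summit.ValiantsHypothesis.ValiantsHypothesis.Theorems.ValuativeFlip

open scoped BigOperators Matrix ComplexConjugate
open MvPolynomial
open Literature.NumberTheory.DiophantineGeometry
open Literature.Computability.AlgebraicComplexity
open Literature.Computability.Complexity

noncomputable section

/-! ## The general every-`j` transfer along closure points, and the determinant at every step -/

/-- **Every-`j` row-lift transfer along closure points (BLMW 2011 Problem 6.10 "≥", general form).**  Let `p` be a
form of degree `m` on `MatIdx m`, `λ ⊢ m·δ` with at most `m²` parts, `j` ANY padding, and `q` a nonzero form of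
degree `m + j` on `MatIdx (m + j)` whose orbit closure contains the padded points `X_top^j · ι(A · p)` for ALL
matrices `A`.  Then `mult_{λ*} ℂ[Δ_m(p)] ≤ mult_{(λ♯(m+j))*} ℂ[Δ_{m+j}(q)]` — with no exceptional `j` (the tree's
`orbitMultiplicity_le_rowLift_eventually_of_closurePoints`, p118342, made exact by twist positivity: the lifted
highest-weight vectors of a complement of `H ∩ tw⁻¹ I(GL·p)` have linearly independent twisted evaluations, and
`dim (H ∩ tw⁻¹ I) ≤ dim (H ∩ I)`). [this crux] -/
theorem orbitMultiplicity_le_rowLift_of_closurePoints {m : ℕ} [NeZero m]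
    (p : MvPolynomial (MatIdx m) ℂ) (hp : p.IsHomogeneous m) {δ : ℕ} (lam : Nat.Partition (m * δ))
    (hlam : lam.parts.card ≤ m * m) (j : ℕ) [NeZero (m + j)] (q : MvPolynomial (MatIdx (m + j)) ℂ)
    (hq : q.IsHomogeneous (m + j)) (hq0 : q ≠ 0)
    (hpts : ∀ A : Matrix (MatIdx m) (MatIdx m) ℂ,
      paddedForm m j (linSubst (MatIdx m) ℂ A p) ∈ orbitClosure q) :
    orbitMultiplicity ℂ p m (partitionWeightLex m lam) ≤
      orbitMultiplicity ℂ q (m + j) (partitionWeightLex (m + j) (rowLift lam j)) := by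
  classical
  set χ := partitionWeightLex m lam with hχ
  set HW := highestWeightSpace (coordRep (MatIdx m) ℂ m) χ with hHW
  set Sd : Submodule ℂ (MvPolynomial (DegIdx (MatIdx m) m) ℂ) := homogeneousSubmodule (DegIdx (MatIdx m) m) ℂ δ with hSd
  set I : Submodule ℂ (MvPolynomial (DegIdx (MatIdx m) m) ℂ) := (orbitVanishingIdeal p m).restrictScalars ℂ with hI
  let a : DegIdx (MatIdx m) m → ℕ := fun e => (e.1 (topMatIdx m) + j).descFactorial j
  have ha : ∀ e, 0 < a e := fun e =>
    Nat.pos_of_ne_zero ((Nat.descFactorial_eq_zero_iff_lt.not).mpr (by omega))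
  set tw : MvPolynomial (DegIdx (MatIdx m) m) ℂ →ₐ[ℂ] MvPolynomial (DegIdx (MatIdx m) m) ℂ :=
    aeval (fun e => C ((a e : ℕ) : ℂ) * X e) with htw
  have hm : m ≠ 0 := NeZero.ne m
  have hHWle : HW ≤ Sd := fun F hF => (mem_homogeneousSubmodule δ F).mpr
    (isHomogeneous_of_mem_highestWeightSpace hm hF (size_partitionWeightLex' lam hlam))
  haveI : FiniteDimensional ℂ ↥HW := finiteDimensional_highestWeightSpace_coordRep_holds (k := ℂ) hm χ
  have hpos := tp_finrank_inf_comap_twist_le p m δ χ a ha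
  rw [inf_eq_left.mpr hHWle] at hpos
  set K : Submodule ℂ (MvPolynomial (DegIdx (MatIdx m) m) ℂ) := HW ⊓ I.comap tw.toLinearMap with hK
  have hKle : K ≤ HW := inf_le_left
  obtain ⟨Q, hQ⟩ := Submodule.exists_isCompl (K.comap HW.subtype)
  have hdimKQ := Submodule.finrank_add_eq_of_isCompl hQ
  rw [LinearEquiv.finrank_eq (Submodule.comapSubtypeEquivOfLe hKle)] at hdimKQ
  haveI : FiniteDimensional ℂ ↥Q := FiniteDimensional.finiteDimensional_submodule Q
  haveI : Module.Free ℂ ↥Q := Module.Free.of_divisionRing ℂ ↥Q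
  let bQ := Module.finBasis ℂ ↥Q
  let F := fun i => (((bQ i : ↥Q) : ↥HW) : MvPolynomial (DegIdx (MatIdx m) m) ℂ)
  have hF : ∀ i, F i ∈ highestWeightSpace (coordRep (MatIdx m) ℂ m) (partitionWeightLex m lam) :=
    fun i => ((bQ i : ↥Q) : ↥HW).2
  let φ := fun i (A : Matrix (MatIdx m) (MatIdx m) ℂ) =>
    MvPolynomial.aeval (fun e : DegIdx (MatIdx m) m =>
      (((e.1 (topMatIdx m) + j).descFactorial j : ℕ) : ℂ) * MvPolynomial.coeff e.1 (linSubst (MatIdx m) ℂ A p)) (F i)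
  have hφtw : ∀ i A, φ i A = aeval (formCoeff m (linSubst (MatIdx m) ℂ A p)) (tw (F i)) := by
    intro i A
    rw [htw, tp_aeval_twist]
    simp only [φ, a, formCoeff_apply]
  have hφlin : LinearIndependent ℂ φ := by
    rw [Fintype.linearIndependent_iff]
    intro c hc
    set Gq : ↥Q := ∑ i, c i • bQ i with hGq
    have hG : ((Gq : ↥HW) : MvPolynomial (DegIdx (MatIdx m) m) ℂ) = ∑ i, c i • F i := by
      simp only [hGq, Submodule.coe_sum, Submodule.coe_smul, F]
    have htwG : tw (∑ i, c i • F i) ∈ orbitVanishingIdeal p m := by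
      rw [mem_orbitVanishingIdeal_iff]
      intro g
      rw [linSubstRep_apply]
      have h0 := congrFun hc (g : Matrix (MatIdx m) (MatIdx m) ℂ)
      simp only [Finset.sum_apply, Pi.smul_apply, smul_eq_mul, Pi.zero_apply] at h0
      rw [map_sum, map_sum]
      simp only [map_smul, smul_eq_mul]
      rw [← h0]
      refine Finset.sum_congr rfl fun i _ => ?_
      rw [hφtw]
    have hGK : ((Gq : ↥HW) : MvPolynomial (DegIdx (MatIdx m) m) ℂ) ∈ K := by
      refine ⟨((Gq : ↥HW)).2, ?_⟩
      change tw (((Gq : ↥HW) : MvPolynomial (DegIdx (MatIdx m) m) ℂ)) ∈ orbitVanishingIdeal p m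
      rw [hG]
      exact htwG
    have hGq0 : Gq = 0 := by
      have hmem : (Gq : ↥HW) ∈ K.comap HW.subtype ⊓ Q := ⟨hGK, Gq.2⟩
      rw [hQ.inf_eq_bot, Submodule.mem_bot] at hmem
      exact (Submodule.coe_eq_zero).mp hmem
    rw [hGq] at hGq0
    intro i
    have hrepr := bQ.repr_sum_self c
    rw [hGq0, map_zero] at hrepr
    have hi := congrFun hrepr i
    simp only [Finsupp.coe_zero, Pi.zero_apply] at hi
    exact hi.symm
  obtain ⟨A, hA⟩ := exists_det_eval_ne_zero_of_linearIndependent _ φ hφlin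
  -- the lifted highest-weight vectors and the padded closure points
  have hG : ∀ i, liftHWV m j (F i) ∈ highestWeightSpace (coordRep (MatIdx (m + j)) ℂ (m + j))
      (partitionWeightLex (m + j) (rowLift lam j)) := fun i => liftHWV_mem_highestWeightSpace lam hlam j (hF i)
  have hrows : (fun i => fun l => aeval (formCoeff (m + j) (paddedForm m j (linSubst (MatIdx m) ℂ (A l) p)))
        (liftHWV m j (F i))) = fun i => fun l => φ i (A l) := by
    funext i l
    rw [aeval_formCoeff_paddedForm_liftHWV j (linSubst_isHomogeneous (A l) hp) (F i)]
  have hM : LinearIndependent ℂ (fun i => fun l =>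
      aeval (formCoeff (m + j) (paddedForm m j (linSubst (MatIdx m) ℂ (A l) p))) (liftHWV m j (F i))) := by
    rw [hrows]
    exact Matrix.linearIndependent_rows_of_det_ne_zero hA
  have hle := le_orbitMultiplicity_of_closure_certificate (NeZero.ne (m + j)) hq hq0
    (partitionWeightLex (m + j) (rowLift lam j)) (fun i => liftHWV m j (F i)) hG
    (fun l => paddedForm m j (linSubst (MatIdx m) ℂ (A l) p)) (fun l => hpts (A l)) hM
  have hmult : orbitMultiplicity ℂ p m χ + Module.finrank ℂ ↥(HW ⊓ I) = Module.finrank ℂ ↥HW :=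
    tp_orbitMultiplicity_eq_finrank_sub p hm χ
  have hpos' : Module.finrank ℂ ↥K ≤ Module.finrank ℂ ↥(HW ⊓ I) := hpos
  omega

/-- **The determinant at EVERY step of the padding ray**: for every inner shape `μ ⊢ n·δ` with at most `n²`
parts and EVERY `j`, `K_n(μ*) ≤ K_{n+j}((μ♯(n+j))*)`, `K_m(λ*) = mult_{λ*} ℂ[Δ(det_m)]` — `det_eventualMonotone`
(p118342) without the threshold `j₀` (`X_top^j · ι(A · det_n) ∈ Δ(det_{n+j})` for all `A`,
`paddedForm_linSubst_detFormLex_mem_orbitClosure`, + the every-`j` transfer). [this crux] -/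
theorem det_everyStepMonotone (n δ : ℕ) [NeZero n] (μ : Nat.Partition (n * δ)) (hμ : μ.parts.card ≤ n * n)
    (j : ℕ) [NeZero (n + j)] :
    orbitMultiplicity ℂ (detFormLex ℂ n) n (partitionWeightLex n μ) ≤
      orbitMultiplicity ℂ (detFormLex ℂ (n + j)) (n + j) (partitionWeightLex (n + j) (rowLift μ j)) :=
  orbitMultiplicity_le_rowLift_of_closurePoints (detFormLex ℂ n) (detFormLex_isHomogeneous ℂ n) μ hμ j
    (detFormLex ℂ (n + j)) (detFormLex_isHomogeneous ℂ (n + j))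
    (fun h => Matrix.det_mvPolynomialX_ne_zero (m := Fin (n + j)) (R := ℂ)
      (rename_injective _ toLex.injective (h.trans (map_zero _).symm)))
    fun A => paddedForm_linSubst_detFormLex_mem_orbitClosure n j A

end

end Summit.ValiantsHypothesis.ValiantsHypothesis.Theorems.ValuativeFlip
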